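import Mathlib.MeasureTheory.Integral.Pi
import Literature.Analysis.FluidPDE.HardSphereDynamicsProofs
import Summits.AtomisticToContinuum.HydrodynamicLimit.Theorems.VitaliAmplitudeTransferAmplitudeTransferScore

/-!
# Amplitude transfer — the unnormalised local Gibbs weight along a path of profiles

Step (4) of the Vitali amplitude transfer (route `VitaliAmplitudeTransfer`, item
`AmplitudeTransfer`): for `N + 1` hard spheres and a path `s ↦ (a_s, u_s, θ_s)` of local Gibbs
profiles, the unnormalised weight `F_s(z) = 𝟙_D(z) ∏ᵢ f_s(zᵢ)` (with `f_s = a_s M_{1,u_s,θ_s}`):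

* Gaussian envelope of `F_s` uniform along the path, bounds on the total score `∑ᵢ π_s(zᵢ)` and on
  one-body empirical observables, integrability of the envelope;
* `hasDerivAt_weight` — `∂_s F_s(z) = (∑ᵢ π_s(zᵢ)) F_s(z)`.

The weighted integrals `s ↦ ∫ X F_s dz` (differentiation under the integral sign, continuity) are
treated in the companion file `…WeightIntegrals`.

The score is written out explicitly (see the `Score` file); no definition is introduced.
-/

noncomputable section

open MeasureTheory Real Filter Set Topology
open scoped InnerProductSpace ENNReal

namespace Summit.AtomisticToContinuum.HydrodynamicLimit.Theorems.AmplitudeTransfer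

open Literature.MathematicalPhysics.KineticTheory Literature.Analysis.FluidPDE

variable {σ : ℝ} {N : ℕ}

/-! ### Pointwise bounds -/

/-- The kinetic energy controls `∑ᵢ (1 + |vᵢ|²) = (N+1) + 2E(z)`. -/
theorem sum_one_add_norm_sq (z : Config (N + 1) (Fin 3) T3) :
    ∑ i, (1 + ‖(z i).2‖ ^ 2) = ((N : ℝ) + 1) + 2 * configEnergy z := by
  rw [Finset.sum_add_distrib, configEnergy]
  simp only [Finset.sum_const, Finset.card_univ, Fintype.card_fin, nsmul_eq_mul, Nat.cast_add,
    Nat.cast_one, mul_one]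
  ring

/-- The kinetic energy is nonnegative. -/
theorem configEnergy_nonneg' (z : Config (N + 1) (Fin 3) T3) : 0 ≤ configEnergy z := by
  unfold configEnergy
  positivity

/-- The Gaussian exponents add up to the kinetic energy: `∑ᵢ -|vᵢ|²/(2c) = -E(z)/c`. -/
theorem sum_neg_norm_sq_div_eq (z : Config (N + 1) (Fin 3) T3) (c : ℝ) :
    ∑ i, (-‖(z i).2‖ ^ 2 / (2 * c)) = -configEnergy z / c := by
  rw [configEnergy, Finset.mul_sum, ← Finset.sum_neg_distrib, Finset.sum_div]
  refine Finset.sum_congr rfl fun i _ => by ring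

/-- The Gaussian exponents add up to the kinetic energy (form with `4B`). -/
theorem sum_neg_norm_sq_div_four_eq (z : Config (N + 1) (Fin 3) T3) (B : ℝ) :
    ∑ i, (-‖(z i).2‖ ^ 2 / (4 * B)) = -configEnergy z / (2 * B) := by
  rw [← sum_neg_norm_sq_div_eq z (2 * B)]
  refine Finset.sum_congr rfl fun i _ => by ring

/-- **Envelope of the weight, uniform along the path**: within profile bounds `B ≥ 1`,
`0 ≤ F(z) ≤ C_B^{N+1} exp (-E(z)/(2B))`. -/
theorem weight_nonneg_le {B : ℝ} (hB : 1 ≤ B) {a₀ θ₀ : T3 → ℝ} {u₀ : T3 → V3}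
    (hbd : ∀ x, B⁻¹ ≤ a₀ x ∧ a₀ x ≤ B ∧ B⁻¹ ≤ θ₀ x ∧ θ₀ x ≤ B ∧ ‖u₀ x‖ ≤ B)
    (z : Config (N + 1) (Fin 3) T3) :
    0 ≤ ((hardSphereDomain (Torus.geometry (Fin 3)) (N + 1) (hsDiameter σ N)).indicator (tensorPow (N + 1) (localGibbsProfile a₀ u₀ θ₀))) z ∧
      ((hardSphereDomain (Torus.geometry (Fin 3)) (N + 1) (hsDiameter σ N)).indicator (tensorPow (N + 1) (localGibbsProfile a₀ u₀ θ₀))) z ≤ (B * (2 * π * B⁻¹) ^ (-(3 : ℝ) / 2) * Real.exp (B / 2)) ^ (N + 1) * Real.exp (-configEnergy z / (2 * B)) := by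
  have hB0 : 0 < B := by linarith
  have ha0 : ∀ x, 0 ≤ a₀ x := fun x => le_trans (inv_pos.2 hB0).le (hbd x).1
  have hθ0 : ∀ x, 0 ≤ θ₀ x := fun x => le_trans (inv_pos.2 hB0).le (hbd x).2.2.1
  have hf0 : ∀ y, 0 ≤ localGibbsProfile a₀ u₀ θ₀ y := localGibbsProfile_nonneg ha0 hθ0
  have htp : 0 ≤ tensorPow (N + 1) (localGibbsProfile a₀ u₀ θ₀) z := tensorPow_nonneg hf0 _ z
  have hprod : tensorPow (N + 1) (localGibbsProfile a₀ u₀ θ₀) z ≤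
      (B * (2 * π * B⁻¹) ^ (-(3 : ℝ) / 2) * Real.exp (B / 2)) ^ (N + 1) * Real.exp (-configEnergy z / (2 * B)) := by
    change ∏ i, localGibbsProfile a₀ u₀ θ₀ (z i) ≤ _
    calc ∏ i, localGibbsProfile a₀ u₀ θ₀ (z i)
        ≤ ∏ i, (B * (2 * π * B⁻¹) ^ (-(3 : ℝ) / 2) * Real.exp (B / 2)) * Real.exp (-‖(z i).2‖ ^ 2 / (4 * B)) :=
          Finset.prod_le_prod (fun i _ => hf0 _) fun i _ =>
            localGibbsProfile_le_envelope hB (z i).1 (z i).2 (hbd _).2.1 (hbd _).2.2.1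
              (hbd _).2.2.2.1 (hbd _).2.2.2.2
      _ = (B * (2 * π * B⁻¹) ^ (-(3 : ℝ) / 2) * Real.exp (B / 2)) ^ (N + 1) * Real.exp (-configEnergy z / (2 * B)) := by
          rw [Finset.prod_mul_distrib, Finset.prod_const, Finset.card_univ, Fintype.card_fin,
            ← Real.exp_sum, sum_neg_norm_sq_div_four_eq z B]
  by_cases hz : z ∈ (hardSphereDomain (Torus.geometry (Fin 3)) (N + 1) (hsDiameter σ N))
  · rw [Set.indicator_of_mem hz]
    exact ⟨htp, hprod⟩
  · rw [Set.indicator_of_notMem hz]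
    exact ⟨le_rfl, by positivity⟩

/-- **Bound on the total score**: if `|π(y)| ≤ K (1 + |v|²)` then
`|∑ᵢ π(zᵢ)| ≤ K ((N+1) + 2E(z))`. -/
theorem abs_sum_le_of_growth {π₀ : T3 × V3 → ℝ} {K : ℝ} (hπ : ∀ y, |π₀ y| ≤ K * (1 + ‖y.2‖ ^ 2))
    (z : Config (N + 1) (Fin 3) T3) :
    |∑ i, π₀ (z i)| ≤ K * (((N : ℝ) + 1) + 2 * configEnergy z) := by
  calc |∑ i, π₀ (z i)| ≤ ∑ i, |π₀ (z i)| := Finset.abs_sum_le_sum_abs _ _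
    _ ≤ ∑ i, K * (1 + ‖(z i).2‖ ^ 2) := Finset.sum_le_sum fun i _ => hπ _
    _ = K * (((N : ℝ) + 1) + 2 * configEnergy z) := by
        rw [← Finset.mul_sum, sum_one_add_norm_sq]

/-- **Bound on one-body empirical observables**: if `|w(y)| ≤ C_w (1 + |v|²)` then
`|∫ w dμ_z| ≤ C_w (1 + 2E(z))` for a configuration `z` of `N + 1` particles. -/
theorem abs_integral_empiricalMeasure_le {w : T3 × V3 → ℝ} {Cw : ℝ}
    (hw : ∀ y, |w y| ≤ Cw * (1 + ‖y.2‖ ^ 2)) (z : Config (N + 1) (Fin 3) T3) :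
    |∫ y, w y ∂(empiricalMeasure z)| ≤ Cw * (1 + 2 * configEnergy z) := by
  have hCw : 0 ≤ Cw := by
    have h := hw ((z 0).1, 0)
    simp only [norm_zero] at h
    have : (0 : ℝ) ^ 2 = 0 := by norm_num
    rw [this, add_zero, mul_one] at h
    exact (abs_nonneg _).trans h
  have hN : (0 : ℝ) < (N : ℝ) + 1 := by positivity
  rw [integral_empiricalMeasure]
  simp only [Nat.cast_add, Nat.cast_one]
  rw [abs_mul, abs_of_pos (inv_pos.2 hN)]
  have hsum : |∑ i, w (z i)| ≤ Cw * (((N : ℝ) + 1) + 2 * configEnergy z) :=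
    abs_sum_le_of_growth hw z
  have hE := configEnergy_nonneg' z
  calc ((N : ℝ) + 1)⁻¹ * |∑ i, w (z i)| ≤ ((N : ℝ) + 1)⁻¹ * (Cw * (((N : ℝ) + 1) + 2 * configEnergy z)) :=
        mul_le_mul_of_nonneg_left hsum (inv_pos.2 hN).le
    _ = Cw * (1 + ((N : ℝ) + 1)⁻¹ * (2 * configEnergy z)) := by field_simp
    _ ≤ Cw * (1 + 1 * (2 * configEnergy z)) := by
        gcongr
        rw [inv_le_comm₀ hN one_pos, inv_one]
        linarith
    _ = Cw * (1 + 2 * configEnergy z) := by ring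

/-- Polynomial weights are absorbed by the Gaussian: `1 + 2E ≤ (1 + 16B) exp (E/(8B))` for
`E ≥ 0`, `B ≥ 1`. -/
theorem one_add_two_mul_le_exp {B E : ℝ} (hB : 1 ≤ B) (hE : 0 ≤ E) :
    1 + 2 * E ≤ (1 + 16 * B) * Real.exp (E / (8 * B)) := by
  have hB0 : 0 < B := by linarith
  have h1 : 1 + E / (8 * B) ≤ Real.exp (E / (8 * B)) := by
    have := Real.add_one_le_exp (E / (8 * B)); linarith
  have h2 : 1 + 2 * E ≤ (1 + 16 * B) * (1 + E / (8 * B)) := by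
    have hy : 0 ≤ E / (8 * B) := by positivity
    have : 2 * E = 16 * B * (E / (8 * B)) := by field_simp; ring
    nlinarith
  exact h2.trans (mul_le_mul_of_nonneg_left h1 (by positivity))

/-! ### Integrability of the Gaussian envelope -/

/-- A centred Gaussian `exp (-|v|²/(2θ))` is integrable on `ℝ³`. -/
theorem integrable_exp_neg_norm_sq_div {θ : ℝ} (hθ : 0 < θ) :
    Integrable (fun v : V3 => Real.exp (-‖v‖ ^ 2 / (2 * θ))) := by
  have h := (integrable_localMaxwellian (E := V3) hθ 0).const_mul ((2 * π * θ) ^ ((3 : ℝ) / 2))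
  refine h.congr (Eventually.of_forall fun v => ?_)
  simp only [localMaxwellian, finrank_euclideanSpace_fin, Nat.cast_ofNat, one_mul, sub_zero]
  have hpos : 0 < 2 * π * θ := by positivity
  rw [← mul_assoc, ← Real.rpow_add hpos]
  norm_num

/-- The envelope `exp (-E(z)/(4B))` is integrable on the `(N+1)`-particle phase space. -/
theorem integrable_exp_neg_configEnergy {B : ℝ} (hB : 0 < B) :
    Integrable (fun z : Config (N + 1) (Fin 3) T3 => Real.exp (-configEnergy z / (4 * B))) := by
  have h1 : Integrable (fun y : T3 × V3 => Real.exp (-‖y.2‖ ^ 2 / (2 * (4 * B))))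
      ((volume : Measure T3).prod (volume : Measure V3)) := by
    have h := (integrable_const (1 : ℝ) (μ := (volume : Measure T3))).mul_prod
      (integrable_exp_neg_norm_sq_div (θ := 4 * B) (by positivity))
    simpa using h
  haveI : SigmaFinite (volume : Measure (T3 × V3)) :=
    (inferInstance : SigmaFinite ((volume : Measure T3).prod (volume : Measure V3)))
  have h2 := Integrable.fintype_prod (ι := Fin (N + 1)) (μ := fun _ => (volume : Measure (T3 × V3)))
    (f := fun _ (y : T3 × V3) => Real.exp (-‖y.2‖ ^ 2 / (2 * (4 * B)))) fun _ => h1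
  refine (h2.congr (Eventually.of_forall fun z => ?_) : Integrable _ (Measure.pi fun _ => volume))
  simp only
  rw [← Real.exp_sum, sum_neg_norm_sq_div_eq z (4 * B)]

/-- A `σ`-independent corollary: `exp (-E/(2B)) ≤ exp (-E/(4B))` for `E ≥ 0`. -/
theorem exp_neg_half_le_quarter {B E : ℝ} (hB : 0 < B) (hE : 0 ≤ E) :
    Real.exp (-E / (2 * B)) ≤ Real.exp (-E / (4 * B)) := by
  apply Real.exp_le_exp.2
  rw [neg_div, neg_div, neg_le_neg_iff]
  exact div_le_div_of_nonneg_left hE (by positivity) (by linarith)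

/-! ### Measurability -/

/-- The weight is measurable for continuous profiles. -/
theorem measurable_weight {a₀ θ₀ : T3 → ℝ} {u₀ : T3 → V3} (ha : Continuous a₀) (hθ : Continuous θ₀)
    (hu : Continuous u₀) : Measurable (((hardSphereDomain (Torus.geometry (Fin 3)) (N + 1) (hsDiameter σ N)).indicator (tensorPow (N + 1) (localGibbsProfile a₀ u₀ θ₀)))) :=
  measurable_indicator_tensorPow ha hθ hu _ _

/-- A one-body empirical observable of the time-`t` configuration is measurable. -/
theorem measurable_integral_empiricalMeasure_flow
    (Φ : HardSphereFlow (Torus.geometry (Fin 3)) (hsDiameter σ N) (N + 1))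
    {w : T3 × V3 → ℝ} (hw : Continuous w) (t : ℝ) :
    Measurable fun z : Config (N + 1) (Fin 3) T3 => ∫ y, w y ∂(empiricalMeasure (Φ.flow t z)) := by
  have h : (fun z : Config (N + 1) (Fin 3) T3 => ∫ y, w y ∂(empiricalMeasure (Φ.flow t z))) =
      fun z => ((N + 1 : ℕ) : ℝ)⁻¹ * ∑ i, w ((Φ.flow t z) i) := by
    funext z
    rw [integral_empiricalMeasure]
  rw [h]
  refine measurable_const.mul (Finset.measurable_sum _ fun i _ => ?_)
  exact hw.measurable.comp ((measurable_pi_apply i).comp (Φ.measurable_flow t))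

/-- The total score `z ↦ ∑ᵢ π(zᵢ)` is measurable for a continuous `π`. -/
theorem measurable_sum_comp {π₀ : T3 × V3 → ℝ} (hπ : Continuous π₀) :
    Measurable fun z : Config (N + 1) (Fin 3) T3 => ∑ i, π₀ (z i) :=
  Finset.measurable_sum _ fun i _ => hπ.measurable.comp (measurable_pi_apply i)

/-! ### Almost every configuration of the domain is good; energy conservation -/

/-- Lebesgue-almost every configuration of the hard-sphere domain lies in the good set of the
flow. -/
theorem ae_mem_good_of_mem_dom
    (Φ : HardSphereFlow (Torus.geometry (Fin 3)) (hsDiameter σ N) (N + 1)) :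
    ∀ᵐ z ∂(volume : Measure (Config (N + 1) (Fin 3) T3)), z ∈ (hardSphereDomain (Torus.geometry (Fin 3)) (N + 1) (hsDiameter σ N)) → z ∈ Φ.good := by
  have h := Φ.measure_compl_good
  rw [liouville_eq, Measure.restrict_apply Φ.measurableSet_good.compl] at h
  rw [ae_iff]
  refine measure_mono_null (fun z hz => ?_) h
  simp only [Classical.not_imp, mem_setOf_eq] at hz
  exact ⟨hz.2, hz.1⟩

/-- On the good set the kinetic energy is conserved by the flow. -/
theorem configEnergy_flow_eq (Φ : HardSphereFlow (Torus.geometry (Fin 3)) (hsDiameter σ N) (N + 1))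
    {z : Config (N + 1) (Fin 3) T3} (hz : z ∈ Φ.good) (t : ℝ) :
    configEnergy (Φ.flow t z) = configEnergy z := by
  have h := IsHardSphereTrajectory.configEnergy_eq_holds (Φ.isTrajectory z hz) t 0
  simpa [Φ.flow_zero z hz] using h

/-- The a.e. bound on a one-body empirical observable of the time-`t` configuration in terms of
the initial kinetic energy. -/
theorem ae_abs_obs_le (Φ : HardSphereFlow (Torus.geometry (Fin 3)) (hsDiameter σ N) (N + 1))
    {w : T3 × V3 → ℝ} {Cw : ℝ} (hw : ∀ y, |w y| ≤ Cw * (1 + ‖y.2‖ ^ 2)) (t : ℝ) :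
    ∀ᵐ z ∂(volume : Measure (Config (N + 1) (Fin 3) T3)), z ∈ (hardSphereDomain (Torus.geometry (Fin 3)) (N + 1) (hsDiameter σ N)) →
      |∫ y, w y ∂(empiricalMeasure (Φ.flow t z))| ≤ Cw * (1 + 2 * configEnergy z) := by
  filter_upwards [ae_mem_good_of_mem_dom Φ] with z hz hzD
  have h := abs_integral_empiricalMeasure_le hw (Φ.flow t z)
  rwa [configEnergy_flow_eq Φ (hz hzD) t] at h

/-! ### The derivative of the weight along the path -/

/-- **`∂_s F_s(z) = (∑ᵢ π_s(zᵢ)) F_s(z)`**: along a path of profiles differentiable at `s`, positive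
near `s`, the weight is differentiable in `s` with derivative the total score times the weight. -/
theorem hasDerivAt_weight {a θ : ℝ → T3 → ℝ} {u : ℝ → T3 → V3} {a' θ' : T3 → ℝ} {u' : T3 → V3}
    {s : ℝ} {U : Set ℝ} (hU : U ∈ 𝓝 s) (hpos : ∀ r ∈ U, ∀ x, 0 < a r x ∧ 0 < θ r x)
    (hd : ∀ x, HasDerivAt (fun r => a r x) (a' x) s ∧ HasDerivAt (fun r => θ r x) (θ' x) s ∧
      HasDerivAt (fun r => u r x) (u' x) s)
    (z : Config (N + 1) (Fin 3) T3) :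
    HasDerivAt (fun r => ((hardSphereDomain (Torus.geometry (Fin 3)) (N + 1) (hsDiameter σ N)).indicator (tensorPow (N + 1) (localGibbsProfile (a r) (u r) (θ r)))) z)
      ((∑ i, ((a' (z i).1) / (a s (z i).1) - 3 / 2 * ((θ' (z i).1) / (θ s (z i).1)) + ⟪((z i).2) - (u s (z i).1), (u' (z i).1)⟫_ℝ / (θ s (z i).1) + ‖((z i).2) - (u s (z i).1)‖ ^ 2 * (θ' (z i).1) / (2 * (θ s (z i).1) ^ 2))) * ((hardSphereDomain (Torus.geometry (Fin 3)) (N + 1) (hsDiameter σ N)).indicator (tensorPow (N + 1) (localGibbsProfile (a s) (u s) (θ s)))) z) s := by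
  have hsU : s ∈ U := mem_of_mem_nhds hU
  by_cases hz : z ∈ (hardSphereDomain (Torus.geometry (Fin 3)) (N + 1) (hsDiameter σ N))
  · simp only [Set.indicator_of_mem hz]
    -- on `U` the tensor power is the exponential of the sum of the log-profiles
    have heq : ∀ r ∈ U, tensorPow (N + 1) (localGibbsProfile (a r) (u r) (θ r)) z =
        Real.exp (∑ i, (Real.log (a r (z i).1) - 3 / 2 * Real.log (2 * π * θ r (z i).1) -
          ‖(z i).2 - u r (z i).1‖ ^ 2 / (2 * θ r (z i).1))) := by
      intro r hr
      rw [Real.exp_sum]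
      change ∏ i, localGibbsProfile (a r) (u r) (θ r) (z i) = _
      refine Finset.prod_congr rfl fun i _ => ?_
      have h := localGibbsProfile_eq_exp (a₀ := a r) (θ₀ := θ r) (u₀ := u r) (x := (z i).1)
        (z i).2 (hpos r hr _).1 (hpos r hr _).2
      simpa using h
    have hsum : HasDerivAt (fun r => ∑ i, (Real.log (a r (z i).1) -
        3 / 2 * Real.log (2 * π * θ r (z i).1) - ‖(z i).2 - u r (z i).1‖ ^ 2 / (2 * θ r (z i).1)))
        (∑ i, ((a' (z i).1) / (a s (z i).1) - 3 / 2 * ((θ' (z i).1) / (θ s (z i).1)) + ⟪((z i).2) - (u s (z i).1), (u' (z i).1)⟫_ℝ / (θ s (z i).1) + ‖((z i).2) - (u s (z i).1)‖ ^ 2 * (θ' (z i).1) / (2 * (θ s (z i).1) ^ 2))) s := by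
      refine HasDerivAt.fun_sum fun i _ => ?_
      exact hasDerivAt_logProfile (z i).2 (hd _).1 (hd _).2.1 (hd _).2.2 (hpos s hsU _).1
        (hpos s hsU _).2
    have hexp := hsum.exp
    have hev : (fun r => tensorPow (N + 1) (localGibbsProfile (a r) (u r) (θ r)) z) =ᶠ[𝓝 s]
        fun r => Real.exp (∑ i, (Real.log (a r (z i).1) - 3 / 2 * Real.log (2 * π * θ r (z i).1) -
          ‖(z i).2 - u r (z i).1‖ ^ 2 / (2 * θ r (z i).1))) := by
      filter_upwards [hU] with r hr
      exact heq r hr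
    refine (hexp.congr_of_eventuallyEq hev).congr_deriv ?_
    rw [← heq s hsU, mul_comm]
  · simp only [Set.indicator_of_notMem hz, mul_zero]
    exact hasDerivAt_const s 0

end Summit.AtomisticToContinuum.HydrodynamicLimit.Theorems.AmplitudeTransfer

end
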